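import Summits.HodgeConjecture.HodgeConjecture.Theorems.F0P3cStCharTSLdsOpp       -- ★ p851264 (LH6-p05 g4) S8b: §1 `psTrace_eq_zero_of_forall_classOrbitalIntegral_split_eq_zero` (van Dijk ⇒ `Tr i_G(χ)(f) = 0` off the split classes), §2 `classOrbitalIntegral_indicator_eq_zero_of_disjoint_hyperbolicSet`; brings ★ HyperbolicSet, ★ CasselmanCap, ★ Ch12Sec6, ★ `exists_isCompact_isOpen_mem_subset`
import Summits.HodgeConjecture.HodgeConjecture.Theorems.F0P3cStCharTSEllOpen      -- ★ p851296 (F0P2-p06 g17) S8a: `isOpen_setOf_isRegularElt_and_not_mem_hyperbolicSet` («`G^r ∖ Ω` is open») — discharges LDS-OPP's `hopen`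
import Summits.HodgeConjecture.HodgeConjecture.Theorems.F0P3cStCharTSParField     -- ★ p851306 (LH6-p03 g4) S7: §0 `smoothTrace_eq_of_isConstituentOf_irreducible`; brings ★ `isSmooth_cmPrincipalSeries`, ★ `MonoidHom.continuous_of_continuous_val`
import HarnessLib

/-!
# F0 · P3c · line LH6 «StCharTS» — datum road «PS-VANISH★»: THE CHARACTER OF AN IRREDUCIBLE PRINCIPAL SERIES VANISHES ON THE ELLIPTIC SET `G^e = G^r ∖ Ω`
# of `U(Φ₃)(L⁺_v)` (`v` non-split) — van Dijk's formula [Rogawski1990 §4.9 (4.9.4) p. 56; §12.6 p. 187], DERIVED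

Cell `pub/hodgecm-mathlib`, crux H413 = `stmt-HodgeConjecture-24833` (`--supports` lane, helper), route HCCMUnconditional; seat LH6-p04 (g6), free-hand
census-first TAKING 2026-09-02T12:59Z on the datum road of LH6-p01 (g4) (MAP v4): the «ONE vanishing clause» that LH6-p03 (g4)'s offer (α)
«ELL-CLASS ⟸ KEYS-RED + PS-VANISH» (12:50:17Z) reads as an INPUT.  THEOREMS ONLY, sorry-free, no definition ∕ instance ∕ notation ∕ named fact; the §12.5
datum `𝔇` is a BINDER (road rule §2.1: field hypotheses as `=`∕`↔`).  HONEST LABEL: HC_CM is proved only modulo the 7 printed citations (2 remaining: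
hLiu418 = stmt-HodgeConjecture-24832, h413 = stmt-HodgeConjecture-24833) until rung 0 closes; count-neutral (closes no organ; no leaf edition implied).

THE MATHEMATICS (print, §12.6 p. 187: «all representations of `G` which are not of the form `i_G(χ)` are elliptic» — this file is the easy CONVERSE:
a class of an irreducible `i_G(χ)` is NOT elliptic, i.e. `χ_π ≡ 0` on `G^e`).  Let `π` be the class of an IRREDUCIBLE principal series `i_G(χ₁, χ₂)` (continuous
pair), `γ ∈ G^e ⊆ G^r ∖ Ω` (`Ω` = ★ `hyperbolicSet`, the conjugates of the regular elements of the split torus `M`).  Harish-Chandra (M1) [§1.6 p. 5]: `χ_π` is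
locally constant at `γ` and computes `Tr π`.  `G^r ∖ Ω` is OPEN (★ S8a `isOpen_setOf_isRegularElt_and_not_mem_hyperbolicSet`) and `U(Φ₃)(L⁺_v)` is totally
disconnected, so there is a compact-open `U ∋ γ` inside `G^r ∖ Ω` on which `χ_π` is constant: `Tr π(𝟙_U) = ν(U)·χ_π(γ)`.  But `Tr π = Tr i_G(χ₁, χ₂)` (a constituent
of an IRREDUCIBLE smooth representation is its class, ★ `smoothTrace_eq_of_isConstituentOf_irreducible`), and `Tr i_G(χ₁, χ₂)(𝟙_U) = 0` by van Dijk's formula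
against canonical orbital integrals (★ LDS-OPP §1) since the orbital integrals of `𝟙_U` vanish at the regular split classes, which lie in `Ω ⊆ G ∖ U`
(★ LDS-OPP §2).  As `ν(U) > 0`, `χ_π(γ) = 0`.  (The proof of ★ `ldsCharactersOpposite_of_PS3` with ONE member and (PS1)-type input instead of (PS3).)

* §1 `char_eq_zero_of_isConstituentOf_irreducible` — MODEL level, datum-free: any `Θ` locally constant at `γ` computing `Tr π` against the Haar measure `νQv`
  vanishes at every regular `γ ∉ Ω`, for `π` a class of an irreducible `i_G(χ₁, χ₂)`;
* §2 `char_eq_zero_on_ellG_of_isConstituentOf_irreducible` — DATUM dress at any §12.5 datum `𝔇` with COMPAT `μG = νQv`, `regG ↔ IsRegularElt`, the pin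
  consequence `hEΩ : G^e ⊆ G^r ∖ Ω` (★ S2 «ELL-FIELD») and (M1∀) VERBATIM (the `hM1` binder of ★ `pseudoCoeffTrace_Gqs` ∕ ★ `ldsCharactersOpposite_of_PS3`):
  LH6-p03's clause «`∀ π χ₁ χ₂` continuous, `i_G(χ₁,χ₂)` irreducible `→ π.IsConstituentOf i_G(χ₁,χ₂) → ∀ γ ∈ 𝔇.ellG, 𝔇.char π γ = 0`» token for token
  (continuity in the `ℂ`-valued currency of the junction's `hIrr`∕`hPSpar`);
* §3 `not_isEllipticRep_of_mem_irredPS` — under the `irredPS` field equation `hIrr` of ★ DATUM-JUNCTION (verbatim): `∀ π ∈ 𝔇.irredPS, ¬ 𝔇.IsEllipticRep π`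
  — the converse companion of the carpet ★ `Ch12Sec6.EllipticOfNotPrincipalSeries` (so that, with the carpet, `IsEllipticRep π ↔ π ∉ irredPS`:
  `isEllipticRep_iff_not_mem_irredPS`).

## References
* [Rogawski1990] J. D. Rogawski, *Automorphic Representations of Unitary Groups in Three Variables*, Ann. of Math. Stud. 123 (1990): §12.6 p. 187; §4.9
  Lemma 4.9.2, (4.9.4) p. 56; §12.5 p. 184 (`G^e`); §1.6 p. 5.
* [vanDijk1972] G. van Dijk, *Computation of certain induced characters of 𝔭-adic groups*, Math. Ann. 199 (1972), Thm. p. 237.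
-/

set_option autoImplicit false
-- the mandated namespace has the single-problem summit's repeated segment (`HodgeConjecture.HodgeConjecture`)
set_option linter.dupNamespace false

noncomputable section

open NumberField IsDedekindDomain MeasureTheory MeasureTheory.Measure Filter Topology TopologicalSpace
open scoped Matrix MatrixGroups
open Literature.NumberTheory.Rogawski1990 Literature.NumberTheory.Automorphic Literature.NumberTheory.Automorphic.UnitaryGroup

namespace Summit.HodgeConjecture.HodgeConjecture.Cruxes.H413.F0P3cStCharTSPsVanish

open Literature.NumberTheory.Rogawski1990.Ch12Sec5
open Summit.HodgeConjecture.HodgeConjecture.Cruxes.H413.F0P3cStCharTSTorusDefs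

/-! ## §1 Model level: a class function computing the trace of an irreducible principal series vanishes off `Ω` on `G^r` -/

set_option maxHeartbeats 1600000 in
set_option synthInstance.maxHeartbeats 400000 in
/-- **«PS-VANISH★», MODEL LEVEL.**  On `U(Φ₃)(L⁺_v)` (`v` non-split), let `π` be a class which is a constituent of an IRREDUCIBLE principal series
`i_G(χ₁, χ₂) = cmPrincipalSeries L 3 v (cmTorusCharPair L v χ₁ χ₂)` (continuous pair, `ℂ`-valued currency), and let `Θ : G → ℂ` be locally constant at a
regular `γ ∉ Ω` and compute `Tr π` against the Haar measure `νQv` on every locally constant compactly supported `φ`.  Then `Θ γ = 0`.  Proof: module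
docstring (compact-open `U ∋ γ` in the open set `G^r ∖ Ω` (★ S8a) with `Θ|_U` constant; `Tr π(𝟙_U) = ν(U)·Θ γ`; `Tr π = Tr i_G(χ)` (★ ParField §0);
`Tr i_G(χ)(𝟙_U) = 0` (★ LDS-OPP §1 + §2, van Dijk against the canonical family `mQv`); `ν(U) > 0`).
[cite: Rogawski1990, §12.6 p. 187; §4.9 Lemma 4.9.2, (4.9.4) p. 56; §1.6 p. 5] [cite: vanDijk1972, Thm. p. 237] -/
theorem char_eq_zero_of_isConstituentOf_irreducible
    (L : Type) [Field L] [NumberField L] [IsCMField L] (v : HeightOneSpectrum (𝓞 ↥(maximalRealSubfield L)))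
    (hns : ∀ w : PlacesOver L v, IsCMField.complexConj L • w.1 = w.1)
    [MeasurableSpace (Gqs L v)] [BorelSpace (Gqs L v)]
    [∀ γ : Gqs L v, MeasurableSpace (Gqs L v ⧸ Subgroup.centralizer ({γ} : Set (Gqs L v)))]
    [∀ γ : Gqs L v, BorelSpace (Gqs L v ⧸ Subgroup.centralizer ({γ} : Set (Gqs L v)))]
    (νQv : Measure (Gqs L v)) [νQv.IsHaarMeasure] [νQv.IsMulRightInvariant]
    (mQv : OrbitalMeasureFamily (Gqs L v))
    (hcanQ : mQv.IsCanonical (fun γ => IsRegularElt (γ.val : GL (Fin 3) (UnitaryGroup.LocalRing L v))) νQv)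
    (π : IrrClass (Gqs L v)) (Θ : Gqs L v → ℂ)
    (htr : ∀ φ : Gqs L v → ℂ, IsLocSmooth φ → π.smoothTrace νQv φ = ∫ x, φ x * Θ x ∂νQv)
    (χ₁ : (UnitaryGroup.LocalRing L v)ˣ →* ℂˣ) (χ₂ : ↥(normOneUnits (conjLocal L (IsCMField.complexConj L) v)) →* ℂˣ)
    (h1 : Continuous (fun x => ((χ₁ x : ℂˣ) : ℂ))) (h2 : Continuous (fun x => ((χ₂ x : ℂˣ) : ℂ)))
    (hirr : (UnitaryGroup.cmPrincipalSeries L 3 v (UnitaryGroup.cmTorusCharPair L v χ₁ χ₂)).IsIrreducible)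
    (hc : π.IsConstituentOf (UnitaryGroup.cmPrincipalSeries L 3 v (UnitaryGroup.cmTorusCharPair L v χ₁ χ₂)))
    {γ : Gqs L v} (hγ : IsRegularElt (γ.val : GL (Fin 3) (UnitaryGroup.LocalRing L v))) (hγΩ : γ ∉ hyperbolicSet L v)
    (hlc : ∀ᶠ y in 𝓝 γ, Θ y = Θ γ) :
    Θ γ = 0 := by
  -- a compact-open `U ∋ γ` inside `G^r ∖ Ω` on which `Θ` is constant
  have hopen := F0P3cStCharTSEllOpen.isOpen_setOf_isRegularElt_and_not_mem_hyperbolicSet L v hns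
  have hW : ({g : Gqs L v | IsRegularElt (g.val : GL (Fin 3) (UnitaryGroup.LocalRing L v)) ∧ g ∉ hyperbolicSet L v} ∩
      {y | Θ y = Θ γ}) ∈ 𝓝 γ :=
    inter_mem (hopen.mem_nhds ⟨hγ, hγΩ⟩) hlc
  haveI : TotallyDisconnectedSpace (Gqs L v) := totallyDisconnectedSpace_cmDatum_local L 3 (qsForm L) v
  obtain ⟨O, hOW, hOo, hγO⟩ := mem_nhds_iff.1 hW
  obtain ⟨U, hUc, hUo, hγU, hUO⟩ := Literature.Topology.exists_isCompact_isOpen_mem_subset hOo hγO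
  have hUW : U ⊆ _ := hUO.trans hOW
  have hφ : IsLocSmooth (U.indicator fun _ => (1 : ℂ)) := isLocSmooth_indicator hUo hUc.isClosed hUc
  -- `Tr π(𝟙_U) = ν(U)·Θ γ`
  have hT : π.smoothTrace νQv (U.indicator fun _ => (1 : ℂ)) = (νQv.real U : ℂ) * Θ γ := by
    rw [htr _ hφ]
    exact F0P3cStCharTSCasselmanCap.integral_indicator_mul_eq_of_eqOn νQv hUo.measurableSet _ γ fun g hg => (hUW hg).2
  -- `Tr π = Tr i_G(χ₁, χ₂)` (constituent of an irreducible smooth representation)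
  have hsm : Representation.IsSmooth (G := Gqs L v) (UnitaryGroup.cmPrincipalSeries L 3 v (UnitaryGroup.cmTorusCharPair L v χ₁ χ₂)) :=
    F0P2pCmPrincipalSeriesInterface.isSmooth_cmPrincipalSeries L v _
  have hπ : π.smoothTrace νQv (U.indicator fun _ => (1 : ℂ)) =
      Representation.smoothTrace (G := Gqs L v) (UnitaryGroup.cmPrincipalSeries L 3 v (UnitaryGroup.cmTorusCharPair L v χ₁ χ₂)) νQv
        (U.indicator fun _ => (1 : ℂ)) :=
    F0P3cStCharTSParField.smoothTrace_eq_of_isConstituentOf_irreducible π νQv _ hc hirr hsm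
  -- `Tr i_G(χ₁, χ₂)(𝟙_U) = 0`: the orbital integrals of `𝟙_U` vanish at the regular split classes (`U ∩ Ω = ∅`), van Dijk
  have h0 : Representation.smoothTrace (G := Gqs L v)
      (UnitaryGroup.cmPrincipalSeries L 3 v (UnitaryGroup.cmTorusCharPair L v χ₁ χ₂)) νQv (U.indicator fun _ => (1 : ℂ)) = 0 :=
    F0P3cStCharTSLdsOpp.psTrace_eq_zero_of_forall_classOrbitalIntegral_split_eq_zero L v hns νQv mQv hcanQ _ hφ
      (fun t ht => F0P3cStCharTSLdsOpp.classOrbitalIntegral_indicator_eq_zero_of_disjoint_hyperbolicSet L v mQv (fun g hg => (hUW hg).1.2) t ht)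
      (χ₁, χ₂) (MonoidHom.continuous_of_continuous_val _ h1) (MonoidHom.continuous_of_continuous_val _ h2)
  rw [hπ, h0] at hT
  -- `ν(U) > 0`
  have hpos : (νQv.real U : ℂ) ≠ 0 := by
    have hp : 0 < νQv.real U :=
      ENNReal.toReal_pos (hUo.measure_pos νQv ⟨γ, hγU⟩).ne' hUc.measure_lt_top.ne
    exact_mod_cast hp.ne'
  exact (mul_eq_zero.1 hT.symm).resolve_left hpos

/-! ## §2 Datum dress: `χ_π ≡ 0` on `G^e` for a class of an irreducible principal series -/

set_option maxHeartbeats 1600000 in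
set_option synthInstance.maxHeartbeats 400000 in
/-- **«PS-VANISH★» AT A §12.5 DATUM** `𝔇` on `U(Φ₃)(L⁺_v)` (`v` non-split) with COMPAT `𝔇.μG = νQv`, `regG ↔ IsRegularElt`, the pin consequence
`hEΩ : G^e ⊆ G^r ∖ Ω` (slice S2 «ELL-FIELD★») and (M1∀) = Harish-Chandra regularity for EVERY class [§1.6 p. 5] (the `hM1` binder of ★
`F0P3cStCharTSLdsOpp.ldsCharactersOpposite_of_PS3` token for token): **for every class `π` of an IRREDUCIBLE principal series `i_G(χ₁, χ₂)` (continuous pair)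
and every `γ ∈ G^e`, `χ_π(γ) = 0`** — LH6-p03 (g4)'s vanishing clause of «ELL-CLASS» token for token. [cite: Rogawski1990, §12.6 p. 187; §4.9 (4.9.4) p. 56; §1.6 p. 5]
[cite: vanDijk1972, Thm. p. 237] -/
theorem char_eq_zero_on_ellG_of_isConstituentOf_irreducible
    (L : Type) [Field L] [NumberField L] [IsCMField L] (v : HeightOneSpectrum (𝓞 ↥(maximalRealSubfield L)))
    (hns : ∀ w : PlacesOver L v, IsCMField.complexConj L • w.1 = w.1)
    [MeasurableSpace (Gqs L v)] [BorelSpace (Gqs L v)]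
    [∀ γ : Gqs L v, MeasurableSpace (Gqs L v ⧸ Subgroup.centralizer ({γ} : Set (Gqs L v)))]
    [∀ γ : Gqs L v, BorelSpace (Gqs L v ⧸ Subgroup.centralizer ({γ} : Set (Gqs L v)))]
    [MeasurableSpace (Gqs L v ⧸ Subgroup.center (Gqs L v))]
    {H : Type} [Group H] [TopologicalSpace H] [IsTopologicalGroup H] [MeasurableSpace H]
    (νQv : Measure (Gqs L v)) [νQv.IsHaarMeasure] [νQv.IsMulRightInvariant]
    (mQv : OrbitalMeasureFamily (Gqs L v))
    (hcanQ : mQv.IsCanonical (fun γ => IsRegularElt (γ.val : GL (Fin 3) (UnitaryGroup.LocalRing L v))) νQv)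
    (𝔇 : EllipticData (Gqs L v) H)
    -- ══ COMPAT (two of the seven clauses of the (S-𝔇) package) ══
    (hμG : 𝔇.μG = νQv)
    (hreg : ∀ γ : Gqs L v, γ ∈ 𝔇.regG ↔ IsRegularElt (γ.val : GL (Fin 3) (UnitaryGroup.LocalRing L v)))
    -- ══ the elliptic set sits inside `G^r ∖ Ω` (slice S2's pin) ══
    (hEΩ : ∀ γ ∈ 𝔇.ellG, IsRegularElt (γ.val : GL (Fin 3) (UnitaryGroup.LocalRing L v)) ∧ γ ∉ hyperbolicSet L v)
    -- ══ (M1∀): Harish-Chandra regularity of `χ_π` for EVERY class ══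
    (hM1 : ∀ π : IrrClass (Gqs L v), Measurable (𝔇.char π) ∧ LocallyIntegrable (𝔇.char π) 𝔇.μG ∧
      (∀ x ∈ 𝔇.regG, ∀ᶠ y in 𝓝 x, 𝔇.char π y = 𝔇.char π x) ∧
      ∀ φ : Gqs L v → ℂ, IsLocSmooth φ → π.smoothTrace 𝔇.μG φ = ∫ x, φ x * 𝔇.char π x ∂𝔇.μG) :
    ∀ (π : IrrClass (Gqs L v)) (χ₁ : (UnitaryGroup.LocalRing L v)ˣ →* ℂˣ) (χ₂ : ↥(normOneUnits (conjLocal L (IsCMField.complexConj L) v)) →* ℂˣ),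
      Continuous (fun x => ((χ₁ x : ℂˣ) : ℂ)) → Continuous (fun x => ((χ₂ x : ℂˣ) : ℂ)) →
      (UnitaryGroup.cmPrincipalSeries L 3 v (UnitaryGroup.cmTorusCharPair L v χ₁ χ₂)).IsIrreducible →
      π.IsConstituentOf (UnitaryGroup.cmPrincipalSeries L 3 v (UnitaryGroup.cmTorusCharPair L v χ₁ χ₂)) →
      ∀ γ ∈ 𝔇.ellG, 𝔇.char π γ = 0 := by
  intro π χ₁ χ₂ h1 h2 hirr hc γ hγ
  obtain ⟨hγreg, hγΩ⟩ := hEΩ γ hγ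
  obtain ⟨-, -, hlc, htr⟩ := hM1 π
  rw [hμG] at htr
  exact char_eq_zero_of_isConstituentOf_irreducible L v hns νQv mQv hcanQ π (𝔇.char π) htr χ₁ χ₂ h1 h2 hirr hc hγreg hγΩ
    (hlc γ ((hreg γ).2 hγreg))

/-! ## §3 The `irredPS` currency: classes of irreducible principal series are NOT elliptic -/

set_option maxHeartbeats 1600000 in
set_option synthInstance.maxHeartbeats 400000 in
/-- **Classes in the `irredPS` field are NOT elliptic** (★ `IsEllipticRep`: «`χ_π` does not vanish identically on `G^e`», §12.6 p. 187), at any §12.5 datum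
`𝔇` on `U(Φ₃)(L⁺_v)` (`v` non-split) with the COMPAT ∕ pin ∕ (M1∀) hypotheses of §2 and the `irredPS` FIELD EQUATION `hIrr` of ★ DATUM-JUNCTION VERBATIM
(«`π ∈ irredPS` ⇒ `π` is a constituent of some irreducible `i_G(χ₁, χ₂)`, continuous pair»).  The converse companion of the carpet ★
`Ch12Sec6.EllipticOfNotPrincipalSeries`. [cite: Rogawski1990, §12.6 p. 187; §4.9 (4.9.4) p. 56; §1.6 p. 5] [cite: vanDijk1972, Thm. p. 237] -/
theorem not_isEllipticRep_of_mem_irredPS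
    (L : Type) [Field L] [NumberField L] [IsCMField L] (v : HeightOneSpectrum (𝓞 ↥(maximalRealSubfield L)))
    (hns : ∀ w : PlacesOver L v, IsCMField.complexConj L • w.1 = w.1)
    [MeasurableSpace (Gqs L v)] [BorelSpace (Gqs L v)]
    [∀ γ : Gqs L v, MeasurableSpace (Gqs L v ⧸ Subgroup.centralizer ({γ} : Set (Gqs L v)))]
    [∀ γ : Gqs L v, BorelSpace (Gqs L v ⧸ Subgroup.centralizer ({γ} : Set (Gqs L v)))]
    [MeasurableSpace (Gqs L v ⧸ Subgroup.center (Gqs L v))]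
    {H : Type} [Group H] [TopologicalSpace H] [IsTopologicalGroup H] [MeasurableSpace H]
    (νQv : Measure (Gqs L v)) [νQv.IsHaarMeasure] [νQv.IsMulRightInvariant]
    (mQv : OrbitalMeasureFamily (Gqs L v))
    (hcanQ : mQv.IsCanonical (fun γ => IsRegularElt (γ.val : GL (Fin 3) (UnitaryGroup.LocalRing L v))) νQv)
    (𝔇 : EllipticData (Gqs L v) H)
    (hμG : 𝔇.μG = νQv)
    (hreg : ∀ γ : Gqs L v, γ ∈ 𝔇.regG ↔ IsRegularElt (γ.val : GL (Fin 3) (UnitaryGroup.LocalRing L v)))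
    (hEΩ : ∀ γ ∈ 𝔇.ellG, IsRegularElt (γ.val : GL (Fin 3) (UnitaryGroup.LocalRing L v)) ∧ γ ∉ hyperbolicSet L v)
    (hM1 : ∀ π : IrrClass (Gqs L v), Measurable (𝔇.char π) ∧ LocallyIntegrable (𝔇.char π) 𝔇.μG ∧
      (∀ x ∈ 𝔇.regG, ∀ᶠ y in 𝓝 x, 𝔇.char π y = 𝔇.char π x) ∧
      ∀ φ : Gqs L v → ℂ, IsLocSmooth φ → π.smoothTrace 𝔇.μG φ = ∫ x, φ x * 𝔇.char π x ∂𝔇.μG)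
    -- ══ the `irredPS` field equation of ★ DATUM-JUNCTION (verbatim) ══
    (hIrr : ∀ π ∈ 𝔇.irredPS, ∃ (χ₁ : (UnitaryGroup.LocalRing L v)ˣ →* ℂˣ) (χ₂ : ↥(normOneUnits (conjLocal L (IsCMField.complexConj L) v)) →* ℂˣ),
      Continuous (fun x => ((χ₁ x : ℂˣ) : ℂ)) ∧ Continuous (fun x => ((χ₂ x : ℂˣ) : ℂ)) ∧
      (UnitaryGroup.cmPrincipalSeries L 3 v (UnitaryGroup.cmTorusCharPair L v χ₁ χ₂)).IsIrreducible ∧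
      π.IsConstituentOf (UnitaryGroup.cmPrincipalSeries L 3 v (UnitaryGroup.cmTorusCharPair L v χ₁ χ₂))) :
    ∀ π ∈ 𝔇.irredPS, ¬ 𝔇.IsEllipticRep π := by
  intro π hπ hell
  obtain ⟨γ, hγ, hne⟩ := hell
  obtain ⟨χ₁, χ₂, h1, h2, hirr, hc⟩ := hIrr π hπ
  exact hne (char_eq_zero_on_ellG_of_isConstituentOf_irreducible L v hns νQv mQv hcanQ 𝔇 hμG hreg hEΩ hM1 π χ₁ χ₂ h1 h2 hirr hc γ hγ)

set_option maxHeartbeats 1600000 in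
set_option synthInstance.maxHeartbeats 400000 in
/-- **`π` is elliptic iff it is not in `irredPS`**, at any §12.5 datum on `U(Φ₃)(L⁺_v)` (`v` non-split) satisfying §3's hypotheses AND the carpet ★
`Ch12Sec6.EllipticOfNotPrincipalSeries 𝔇` («all representations not of the form `i_G(χ)` are elliptic», [K]; a NAMED INPUT of the (S-𝔇) organ, hypothesis
here). [cite: Rogawski1990, §12.6 p. 187] -/
theorem isEllipticRep_iff_not_mem_irredPS
    (L : Type) [Field L] [NumberField L] [IsCMField L] (v : HeightOneSpectrum (𝓞 ↥(maximalRealSubfield L)))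
    (hns : ∀ w : PlacesOver L v, IsCMField.complexConj L • w.1 = w.1)
    [MeasurableSpace (Gqs L v)] [BorelSpace (Gqs L v)]
    [∀ γ : Gqs L v, MeasurableSpace (Gqs L v ⧸ Subgroup.centralizer ({γ} : Set (Gqs L v)))]
    [∀ γ : Gqs L v, BorelSpace (Gqs L v ⧸ Subgroup.centralizer ({γ} : Set (Gqs L v)))]
    [MeasurableSpace (Gqs L v ⧸ Subgroup.center (Gqs L v))]
    {H : Type} [Group H] [TopologicalSpace H] [IsTopologicalGroup H] [MeasurableSpace H]
    (νQv : Measure (Gqs L v)) [νQv.IsHaarMeasure] [νQv.IsMulRightInvariant]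
    (mQv : OrbitalMeasureFamily (Gqs L v))
    (hcanQ : mQv.IsCanonical (fun γ => IsRegularElt (γ.val : GL (Fin 3) (UnitaryGroup.LocalRing L v))) νQv)
    (𝔇 : EllipticData (Gqs L v) H)
    (hμG : 𝔇.μG = νQv)
    (hreg : ∀ γ : Gqs L v, γ ∈ 𝔇.regG ↔ IsRegularElt (γ.val : GL (Fin 3) (UnitaryGroup.LocalRing L v)))
    (hEΩ : ∀ γ ∈ 𝔇.ellG, IsRegularElt (γ.val : GL (Fin 3) (UnitaryGroup.LocalRing L v)) ∧ γ ∉ hyperbolicSet L v)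
    (hM1 : ∀ π : IrrClass (Gqs L v), Measurable (𝔇.char π) ∧ LocallyIntegrable (𝔇.char π) 𝔇.μG ∧
      (∀ x ∈ 𝔇.regG, ∀ᶠ y in 𝓝 x, 𝔇.char π y = 𝔇.char π x) ∧
      ∀ φ : Gqs L v → ℂ, IsLocSmooth φ → π.smoothTrace 𝔇.μG φ = ∫ x, φ x * 𝔇.char π x ∂𝔇.μG)
    (hIrr : ∀ π ∈ 𝔇.irredPS, ∃ (χ₁ : (UnitaryGroup.LocalRing L v)ˣ →* ℂˣ) (χ₂ : ↥(normOneUnits (conjLocal L (IsCMField.complexConj L) v)) →* ℂˣ),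
      Continuous (fun x => ((χ₁ x : ℂˣ) : ℂ)) ∧ Continuous (fun x => ((χ₂ x : ℂˣ) : ℂ)) ∧
      (UnitaryGroup.cmPrincipalSeries L 3 v (UnitaryGroup.cmTorusCharPair L v χ₁ χ₂)).IsIrreducible ∧
      π.IsConstituentOf (UnitaryGroup.cmPrincipalSeries L 3 v (UnitaryGroup.cmTorusCharPair L v χ₁ χ₂)))
    -- ══ the carpet «elliptic ⟸ not principal series» (NAMED INPUT) ══
    (hEllNotPS : Ch12Sec6.EllipticOfNotPrincipalSeries 𝔇)
    (π : IrrClass (Gqs L v)) :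
    𝔇.IsEllipticRep π ↔ π ∉ 𝔇.irredPS :=
  ⟨fun hell hπ => not_isEllipticRep_of_mem_irredPS L v hns νQv mQv hcanQ 𝔇 hμG hreg hEΩ hM1 hIrr π hπ hell, hEllNotPS π⟩

end Summit.HodgeConjecture.HodgeConjecture.Cruxes.H413.F0P3cStCharTSPsVanish

end
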